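/-
Copyright: cell `pub-ymgap` (HUMAN RULING D-0062), Track A of `YM-PLAN.md`, DAG node N20 (= NE7b); R134 acceleration seat
`pub-ymgap-dag-n20-c` (strategy s1, generation 0), module 4.  Released under the licence of the surrounding project.
-/
import Summits.QuantumFields.YangMills.Theorems.BalabanUVNodesN20LCSLoopEnergies
import Summits.QuantumFields.BalabanUV.T4Continuum.Spine.NE7b.LocalPlaquetteExpMomentsEven
import HarnessLib

/-!
# YM-DAG node N20 (= NE7b), strategy s1, module 4: the EVEN-TORUS twin of modules 1–2 in the `01`-plane — the transfer (LS)₀ ⇒ (LS)₁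
# from the tree's even-torus class-`01` bound, and UNCONDITIONAL local exponential moments of `01`-plane Wilson loop energies on even
# four-tori `(ℤ∕L)⁴` (NODE 00's tori have EVEN side `2·L^{m+K}` — carrier-junction residual (iii) of module 1, plane by plane)

Track A of `YM-PLAN.md` (cell `pub-ymgap`, HUMAN RULING D-0062), node **N20** = spine estimate NE7b (`T4WeightBudget.RelWeightBound` —
the cell `pub-balaban`'s OWN estimate, NOT PRINTED in [Bałaban 1983–89], NOT PROVED).  Seat `pub-ymgap-dag-n20-c` (R134, s1), module 4.
Kernel theorems only: 0 `def`, 0 `sorry`, standard axioms; COUNT-NEUTRAL; `--supports` the K3 item `SpineGivenEndpointR11`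
(stmt-QuantumFields-19676).  Nothing of Bałaban's is asserted or instantiated.

WHY.  Modules 1–2 (`…N20LCSPushforward` p453912, `…N20LCSLoopEnergies` p455890) live on the ODD four-tori of (LS) rung 0
(`LocalPlaquetteExpMoments.localExpMoment`).  The record's tori (`T4Continuum.GaugeField (F.P K) j`, side `2·L^{m+K−j}`) are EVEN.  The tree's
even-torus rung 0 is `LocalPlaquetteExpMomentsEven.localExpMoment_class01_even` (class `01` only; the other five classes follow by the axis
symmetry of Wilson's measure and are not typed there).  THIS FILE carries the transfer and the loop instance over to even tori in the `01`-plane: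
* §1 **`localExpMoment_dominated_even01`** — for every finite family of observables `O_P ≤ a·β·Σ_{x∈R(P)} A_{(x;0,1)}` dominated by the
  class-`01` fine energies of site regions `R(P)` of multiplicity `≤ m`, `m·a ≤ ½`: `∫ exp(Σ_P O_P) dμ_β ≤ exp(C·(m·a)·#⋃R)` on every even
  four-torus, `β ≥ 4`.
* §2 **`loopEnergy01_le_mul_sum_region`** (the Stokes letter for a `01`-plane rectangle against a SITE region containing its face, `R, T ≤ L`),
  **`localExpMoment_loopEnergies_even01`** (`∫ exp(δβ Σ_P A(hol ∂P)) dμ_β ≤ exp((C∕2)·n·#Q)` for `01`-plane rectangles of area `≤ 𝔞`, site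
  regions `⊇` faces of size `≤ n`, multiplicity `≤ m`, `m·δ·𝔞 ≤ ½`), **`localExpMoment_loopEnergy_even01`** (one loop: `≤ exp(C·δ·(RT)²)`,
  `δ·R·T ≤ ½`) and **`localExpMoment_blockSquares_even01`** (the `01`-plane coarse plaquettes of the side-`b` DECIMATION on an even torus) —
  all UNCONDITIONAL, uniform in `β ≥ 4` and the volume.

HONEST FRAMING.  One coordinate plane; decimation, not Bałaban's smeared `avOfRecord`; the remaining carrier junction is the relabelling
`GaugeConfig 4 L G` ↔ `T4Continuum.GaugeField P j G` of an even torus of the same side (not typed here).  Residuals (i), (ii), (iv) of module 1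
unchanged.  NE7b NOT PRINTED ∕ NOT PROVED; (α)-instance 0∕1; N20 NOT discharged; typed 28∕28, discharged count untouched; one finite four-torus at
fixed `ε` — NOT ℝ⁴, NOT infinite volume, NOT OS, NOT a mass gap, NOT Clay.
-/

set_option autoImplicit false

noncomputable section

namespace Summit.QuantumFields.YangMills.BalabanUVNodes.N20LCSLoopEnergiesEven

open MeasureTheory
open Literature.MathematicalPhysics.QuantumFieldTheory
open Summit.QuantumFields.BalabanUV.T4Continuum.NE7b.LocalPlaquetteExpMoments
  (localExpMoment_class01_even integrable_exp_of_abs_le plaqEnergy_le)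
open Summit.QuantumFields.YangMills.Theorems.FemtoCurvatureTwoPointC.LatticeStokes
  (sub_re_trace_map_rectangleHolonomy_le sub_re_trace_map_nonneg)
open Summit.QuantumFields.YangMills.BalabanUVNodes.N20LCSPushforward (sum_sum_le_mul_sum_biUnion card_biUnion_le_mul)
open Summit.QuantumFields.YangMills.BalabanUVNodes.N20LCSLoopEnergies (faceShift_injOn)

/-! ## §1 The transfer on even tori, class `01` -/

section Transfer

variable {G : Type} [Group G] [TopologicalSpace G] [IsTopologicalGroup G] [CompactSpace G]
  [MeasurableSpace G] [BorelSpace G]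

/-- **THE TRANSFER (LS)₀ ⇒ (LS)₁ ON EVEN TORI, CLASS `01`.**  For a faithful continuous unitary lattice representation `r` of a compact group `G`
there is `C ≥ 0` (the constant of `localExpMoment_class01_even`) such that for every even four-torus `(ℤ∕L)⁴`, every `β ≥ 4`, every finite family
`O_P` (`P ∈ Q`) with site regions `R(P)` of multiplicity `≤ m` and every tilt `a ≥ 0` with `m·a ≤ ½`: if
`O_P(U) ≤ a·β·Σ_{x∈R(P)} (N − Re tr r(U_{(x;0,1)}))` for all `P ∈ Q` and all `U`, then `∫ exp(Σ_{P∈Q} O_P) dμ_β ≤ exp(C·(m·a)·#(⋃_P R(P)))`.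
[folklore] -/
theorem localExpMoment_dominated_even01 (r : LatticeRep G) :
    ∃ C : ℝ, 0 ≤ C ∧ ∀ (L : ℕ) [NeZero L], Even L → ∀ (β : ℝ), 4 ≤ β →
      ∀ (κ : Type) (Q : Finset κ) (R : κ → Finset (Site 4 L)) (O : κ → GaugeConfig 4 L G → ℝ) (a : ℝ) (m : ℕ),
        0 ≤ a → (m : ℝ) * a ≤ 1 / 2 →
        (∀ x ∈ Q.biUnion R, (Q.filter fun P => x ∈ R P).card ≤ m) →
        (∀ P ∈ Q, ∀ U : GaugeConfig 4 L G,
          O P U ≤ a * β * ∑ x ∈ R P, ((r.N : ℝ) - (r.ρ (plaquetteHolonomy U x 0 1)).trace.re)) →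
        ∫ U, Real.exp (∑ P ∈ Q, O P U) ∂(wilsonMeasure r.ρ β : Measure (GaugeConfig 4 L G)) ≤
          Real.exp (C * (m * a) * (Q.biUnion R).card) := by
  obtain ⟨C, hC0, hC⟩ := localExpMoment_class01_even r
  refine ⟨C, hC0, fun L _ hL β hβ κ Q R O a m ha hma hmult hdom => ?_⟩
  classical
  haveI hprob := isProbabilityMeasure_wilsonMeasure (d := 4) (L := L) (G := G) r.ρ r.continuous β
  set μ : Measure (GaugeConfig 4 L G) := wilsonMeasure r.ρ β with hμ
  set X : Finset (Site 4 L) := Q.biUnion R with hX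
  have hβ0 : 0 ≤ β := by linarith
  have hma0 : 0 ≤ (m : ℝ) * a := mul_nonneg (Nat.cast_nonneg m) ha
  have hA0 : ∀ (U : GaugeConfig 4 L G) (x : Site 4 L), 0 ≤ (r.N : ℝ) - (r.ρ (plaquetteHolonomy U x 0 1)).trace.re :=
    fun U x => sub_re_trace_map_nonneg r.ρ r.mem_unitary _
  have hpt : ∀ U : GaugeConfig 4 L G,
      ∑ P ∈ Q, O P U ≤ (m * a) * β * ∑ x ∈ X, ((r.N : ℝ) - (r.ρ (plaquetteHolonomy U x 0 1)).trace.re) := by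
    intro U
    have h1 : ∑ P ∈ Q, O P U ≤ ∑ P ∈ Q, a * β * ∑ x ∈ R P, ((r.N : ℝ) - (r.ρ (plaquetteHolonomy U x 0 1)).trace.re) :=
      Finset.sum_le_sum fun P hP => hdom P hP U
    have h2 : ∑ P ∈ Q, ∑ x ∈ R P, ((r.N : ℝ) - (r.ρ (plaquetteHolonomy U x 0 1)).trace.re) ≤
        m * ∑ x ∈ X, ((r.N : ℝ) - (r.ρ (plaquetteHolonomy U x 0 1)).trace.re) :=
      sum_sum_le_mul_sum_biUnion Q R _ (fun x _ => hA0 U x) m hmult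
    rw [← Finset.mul_sum] at h1
    have hab : 0 ≤ a * β := mul_nonneg ha hβ0
    calc ∑ P ∈ Q, O P U ≤ a * β * ∑ P ∈ Q, ∑ x ∈ R P, ((r.N : ℝ) - (r.ρ (plaquetteHolonomy U x 0 1)).trace.re) := h1
      _ ≤ a * β * (m * ∑ x ∈ X, ((r.N : ℝ) - (r.ρ (plaquetteHolonomy U x 0 1)).trace.re)) :=
          mul_le_mul_of_nonneg_left h2 hab
      _ = (m * a) * β * ∑ x ∈ X, ((r.N : ℝ) - (r.ρ (plaquetteHolonomy U x 0 1)).trace.re) := by ring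
  -- integrability of the dominating exponential: a bounded measurable observable
  have hmeas : Measurable fun U : GaugeConfig 4 L G =>
      (m * a) * β * ∑ x ∈ X, ((r.N : ℝ) - (r.ρ (plaquetteHolonomy U x 0 1)).trace.re) := by
    refine (Finset.measurable_sum X fun x _ => measurable_const.sub ?_).const_mul _
    have h := WilsonRP.measurable_plaqRe (d := 4) (L := L) r.ρ r.continuous
      ((x, ⟨((0 : Fin 4), (1 : Fin 4)), by decide⟩) : Plaquette 4 L)
    exact h
  have hint : Integrable (fun U => Real.exp ((m * a) * β *
      ∑ x ∈ X, ((r.N : ℝ) - (r.ρ (plaquetteHolonomy U x 0 1)).trace.re))) μ := by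
    refine integrable_exp_of_abs_le r.ρ r.continuous β hmeas (B := |(m : ℝ) * a * β| * (2 * r.N * X.card)) fun U => ?_
    rw [abs_mul]
    refine mul_le_mul_of_nonneg_left ?_ (abs_nonneg _)
    rw [abs_of_nonneg (Finset.sum_nonneg fun x _ => hA0 U x)]
    calc ∑ x ∈ X, ((r.N : ℝ) - (r.ρ (plaquetteHolonomy U x 0 1)).trace.re) ≤ ∑ _x ∈ X, (2 * (r.N : ℝ)) :=
          Finset.sum_le_sum fun x _ =>
            plaqEnergy_le r.ρ r.continuous U ((x, ⟨((0 : Fin 4), (1 : Fin 4)), by decide⟩) : Plaquette 4 L)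
      _ = 2 * r.N * X.card := by rw [Finset.sum_const, nsmul_eq_mul]; ring
  calc ∫ U, Real.exp (∑ P ∈ Q, O P U) ∂μ
      ≤ ∫ U, Real.exp ((m * a) * β * ∑ x ∈ X, ((r.N : ℝ) - (r.ρ (plaquetteHolonomy U x 0 1)).trace.re)) ∂μ :=
        integral_mono_of_nonneg (ae_of_all _ fun U => (Real.exp_pos _).le) hint
          (ae_of_all _ fun U => Real.exp_le_exp.2 (hpt U))
    _ ≤ Real.exp (C * (m * a) * X.card) := hC L hL β hβ (m * a) hma0 hma X

end Transfer

/-! ## §2 `01`-plane Wilson loops on even tori -/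

section Loops

variable {L : ℕ} {G : Type} [Group G] {N : ℕ} (ρ : G →* Matrix (Fin N) (Fin N) ℂ)

/-- **THE STOKES LETTER FOR A `01`-PLANE RECTANGLE AGAINST A SITE REGION.**  For a unitary representation `ρ`, a rectangle `R × T` in the
`(0,1)`-plane at `x` with `R, T ≤ L`, and any SITE set `F` containing its face sites `x + s e₀ + t e₁` (`s < R`, `t < T`):
`N − Re tr ρ(hol ∂(R×T)) ≤ R·T·Σ_{y∈F} (N − Re tr ρ(U_{(y;0,1)}))` (tree Stokes bound; the face as an injective image; energies `≥ 0` off it).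
[folklore] -/
theorem loopEnergy01_le_mul_sum_region (hρu : ∀ g, ρ g ∈ Matrix.unitaryGroup (Fin N) ℂ) (U : GaugeConfig 4 L G) (x : Site 4 L)
    {R T : ℕ} (hR : R ≤ L) (hT : T ≤ L) (F : Finset (Site 4 L))
    (hF : (Finset.range R ×ˢ Finset.range T).image
        (fun st : ℕ × ℕ => (x + Pi.single 0 (st.1 : ZMod L) + Pi.single 1 (st.2 : ZMod L) : Site 4 L)) ⊆ F) :
    (N : ℝ) - (ρ (rectangleHolonomy U x 0 1 R T)).trace.re ≤
      ((R * T : ℕ) : ℝ) * ∑ y ∈ F, ((N : ℝ) - (ρ (plaquetteHolonomy U y 0 1)).trace.re) := by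
  classical
  refine (sub_re_trace_map_rectangleHolonomy_le ρ hρu U 0 1 R T x).trans ?_
  have h01 : (0 : Fin 4) ≠ 1 := by decide
  have key : ∑ s ∈ Finset.range R, ∑ t ∈ Finset.range T,
      ((N : ℝ) - (ρ (plaquetteHolonomy U (x + Pi.single 0 (s : ZMod L) + Pi.single 1 (t : ZMod L)) 0 1)).trace.re) =
      ∑ y ∈ (Finset.range R ×ˢ Finset.range T).image
        (fun st : ℕ × ℕ => (x + Pi.single 0 (st.1 : ZMod L) + Pi.single 1 (st.2 : ZMod L) : Site 4 L)),
        ((N : ℝ) - (ρ (plaquetteHolonomy U y 0 1)).trace.re) := by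
    rw [Finset.sum_image (faceShift_injOn x h01 hR hT), ← Finset.sum_product']
  rw [key]
  exact mul_le_mul_of_nonneg_left
    (Finset.sum_le_sum_of_subset_of_nonneg hF fun y _ _ => sub_re_trace_map_nonneg ρ hρu _) (Nat.cast_nonneg _)

omit [Group G] in
/-- The face site set has at most `R·T` elements. [folklore] -/
theorem card_faceSites_le (x : Site 4 L) (R T : ℕ) :
    ((Finset.range R ×ˢ Finset.range T).image
        (fun st : ℕ × ℕ => (x + Pi.single 0 (st.1 : ZMod L) + Pi.single 1 (st.2 : ZMod L) : Site 4 L))).card ≤ R * T := by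
  classical
  refine Finset.card_image_le.trans ?_
  rw [Finset.card_product, Finset.card_range, Finset.card_range]

end Loops

section LoopMoments

variable {G : Type} [Group G] [TopologicalSpace G] [IsTopologicalGroup G] [CompactSpace G]
  [MeasurableSpace G] [BorelSpace G]

/-- **LOCAL EXPONENTIAL MOMENTS OF `01`-PLANE WILSON LOOP ENERGIES ON EVEN TORI.**  With the constant `C` of `localExpMoment_class01_even`:
for every even four-torus `(ℤ∕L)⁴`, every `β ≥ 4`, every finite family of `01`-plane rectangles `P ∈ Q` (base point `x P`, sides `R P, T P ≤ L`,
area `≤ 𝔞`) with site regions `F P ⊇ face P` of size `≤ n` and multiplicity `≤ m`, and every `δ ≥ 0` with `m·δ·𝔞 ≤ ½`: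
`∫ exp(δ·β·Σ_{P∈Q} (N − Re tr r(hol ∂P))) dμ_β ≤ exp((C∕2)·n·#Q)`. [folklore] -/
theorem localExpMoment_loopEnergies_even01 (r : LatticeRep G) :
    ∃ C : ℝ, 0 ≤ C ∧ ∀ (L : ℕ) [NeZero L], Even L → ∀ (β : ℝ), 4 ≤ β →
      ∀ (κ : Type) (Q : Finset κ) (x : κ → Site 4 L) (R T : κ → ℕ) (F : κ → Finset (Site 4 L)) (𝔞 m n : ℕ) (δ : ℝ),
        0 ≤ δ → (m : ℝ) * (δ * 𝔞) ≤ 1 / 2 →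
        (∀ P ∈ Q, R P ≤ L) → (∀ P ∈ Q, T P ≤ L) → (∀ P ∈ Q, R P * T P ≤ 𝔞) →
        (∀ P ∈ Q, (Finset.range (R P) ×ˢ Finset.range (T P)).image
            (fun st : ℕ × ℕ => (x P + Pi.single 0 (st.1 : ZMod L) + Pi.single 1 (st.2 : ZMod L) : Site 4 L)) ⊆ F P) →
        (∀ y ∈ Q.biUnion F, (Q.filter fun P => y ∈ F P).card ≤ m) → (∀ P ∈ Q, (F P).card ≤ n) →
        ∫ U, Real.exp (δ * β * ∑ P ∈ Q, ((r.N : ℝ) - (r.ρ (rectangleHolonomy U (x P) 0 1 (R P) (T P))).trace.re))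
            ∂(wilsonMeasure r.ρ β : Measure (GaugeConfig 4 L G)) ≤
          Real.exp (C / 2 * (n * Q.card)) := by
  obtain ⟨C, hC0, hC⟩ := localExpMoment_dominated_even01 r
  refine ⟨C, hC0, fun L _ hL β hβ κ Q x R T F 𝔞 m n δ hδ hsmall hR hT hA hF hmult hn => ?_⟩
  classical
  have hβ0 : 0 ≤ β := by linarith
  have ha : 0 ≤ δ * 𝔞 := mul_nonneg hδ (Nat.cast_nonneg _)
  have hdom : ∀ P ∈ Q, ∀ U : GaugeConfig 4 L G,
      δ * β * ((r.N : ℝ) - (r.ρ (rectangleHolonomy U (x P) 0 1 (R P) (T P))).trace.re) ≤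
        δ * 𝔞 * β * ∑ y ∈ F P, ((r.N : ℝ) - (r.ρ (plaquetteHolonomy U y 0 1)).trace.re) := by
    intro P hP U
    have h1 := loopEnergy01_le_mul_sum_region r.ρ r.mem_unitary U (x P) (hR P hP) (hT P hP) (F P) (hF P hP)
    have hS0 : 0 ≤ ∑ y ∈ F P, ((r.N : ℝ) - (r.ρ (plaquetteHolonomy U y 0 1)).trace.re) :=
      Finset.sum_nonneg fun y _ => sub_re_trace_map_nonneg r.ρ r.mem_unitary _
    have h2 : (((R P * T P : ℕ) : ℝ)) * ∑ y ∈ F P, ((r.N : ℝ) - (r.ρ (plaquetteHolonomy U y 0 1)).trace.re) ≤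
        (𝔞 : ℝ) * ∑ y ∈ F P, ((r.N : ℝ) - (r.ρ (plaquetteHolonomy U y 0 1)).trace.re) :=
      mul_le_mul_of_nonneg_right (by exact_mod_cast hA P hP) hS0
    have hδβ : 0 ≤ δ * β := mul_nonneg hδ hβ0
    calc δ * β * ((r.N : ℝ) - (r.ρ (rectangleHolonomy U (x P) 0 1 (R P) (T P))).trace.re)
        ≤ δ * β * ((𝔞 : ℝ) * ∑ y ∈ F P, ((r.N : ℝ) - (r.ρ (plaquetteHolonomy U y 0 1)).trace.re)) :=
          mul_le_mul_of_nonneg_left (h1.trans h2) hδβ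
      _ = δ * 𝔞 * β * ∑ y ∈ F P, ((r.N : ℝ) - (r.ρ (plaquetteHolonomy U y 0 1)).trace.re) := by ring
  have hmain := hC L hL β hβ κ Q F
    (fun P U => δ * β * ((r.N : ℝ) - (r.ρ (rectangleHolonomy U (x P) 0 1 (R P) (T P))).trace.re))
    (δ * 𝔞) m ha hsmall hmult hdom
  have hsum : ∀ U : GaugeConfig 4 L G,
      ∑ P ∈ Q, δ * β * ((r.N : ℝ) - (r.ρ (rectangleHolonomy U (x P) 0 1 (R P) (T P))).trace.re) =
        δ * β * ∑ P ∈ Q, ((r.N : ℝ) - (r.ρ (rectangleHolonomy U (x P) 0 1 (R P) (T P))).trace.re) :=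
    fun U => by rw [Finset.mul_sum]
  simp_rw [hsum] at hmain
  refine hmain.trans (Real.exp_le_exp.2 ?_)
  have hcard : ((Q.biUnion F).card : ℝ) ≤ n * Q.card := by exact_mod_cast card_biUnion_le_mul Q F n hn
  have h2 : 0 ≤ C * (m * (δ * 𝔞)) := mul_nonneg hC0 (mul_nonneg (Nat.cast_nonneg m) ha)
  calc C * (m * (δ * 𝔞)) * ((Q.biUnion F).card : ℝ) ≤ C * (m * (δ * 𝔞)) * (n * Q.card) :=
        mul_le_mul_of_nonneg_left hcard h2
    _ ≤ C * (1 / 2) * (n * Q.card) :=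
        mul_le_mul_of_nonneg_right (mul_le_mul_of_nonneg_left hsmall hC0) (by positivity)
    _ = C / 2 * (n * Q.card) := by ring

/-- **ONE `01`-PLANE WILSON LOOP ON AN EVEN TORUS**: with the constant `C` of `localExpMoment_class01_even`, for every even four-torus `(ℤ∕L)⁴`,
every `β ≥ 4`, every rectangle `R × T` (`R, T ≤ L`) in the `(0,1)`-plane and every `δ ≥ 0` with `δ·R·T ≤ ½`:
`∫ exp(δ·β·(N − Re tr r(hol ∂(R×T)))) dμ_β ≤ exp(C·δ·(R·T)²)`. [folklore] -/
theorem localExpMoment_loopEnergy_even01 (r : LatticeRep G) :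
    ∃ C : ℝ, 0 ≤ C ∧ ∀ (L : ℕ) [NeZero L], Even L → ∀ (β : ℝ), 4 ≤ β →
      ∀ (x : Site 4 L) (R T : ℕ) (δ : ℝ), 0 ≤ δ → δ * (R * T) ≤ 1 / 2 → R ≤ L → T ≤ L →
        ∫ U, Real.exp (δ * β * ((r.N : ℝ) - (r.ρ (rectangleHolonomy U x 0 1 R T)).trace.re))
            ∂(wilsonMeasure r.ρ β : Measure (GaugeConfig 4 L G)) ≤
          Real.exp (C * δ * (R * T) ^ 2) := by
  obtain ⟨C, hC0, hC⟩ := localExpMoment_dominated_even01 r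
  refine ⟨C, hC0, fun L _ hL β hβ x R T δ hδ hsmall hR hT => ?_⟩
  classical
  have hβ0 : 0 ≤ β := by linarith
  set face : Finset (Site 4 L) := (Finset.range R ×ˢ Finset.range T).image
    (fun st : ℕ × ℕ => (x + Pi.single 0 (st.1 : ZMod L) + Pi.single 1 (st.2 : ZMod L) : Site 4 L)) with hface
  have ha : 0 ≤ δ * ((R * T : ℕ) : ℝ) := mul_nonneg hδ (Nat.cast_nonneg _)
  have hma : ((1 : ℕ) : ℝ) * (δ * ((R * T : ℕ) : ℝ)) ≤ 1 / 2 := by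
    rw [Nat.cast_one, one_mul, Nat.cast_mul]; exact hsmall
  have hdom : ∀ P ∈ ({()} : Finset Unit), ∀ U : GaugeConfig 4 L G,
      δ * β * ((r.N : ℝ) - (r.ρ (rectangleHolonomy U x 0 1 R T)).trace.re) ≤
        δ * ((R * T : ℕ) : ℝ) * β * ∑ y ∈ face, ((r.N : ℝ) - (r.ρ (plaquetteHolonomy U y 0 1)).trace.re) := by
    intro _ _ U
    have h1 := loopEnergy01_le_mul_sum_region r.ρ r.mem_unitary U x hR hT face (by rw [hface])
    have hδβ : 0 ≤ δ * β := mul_nonneg hδ hβ0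
    calc δ * β * ((r.N : ℝ) - (r.ρ (rectangleHolonomy U x 0 1 R T)).trace.re)
        ≤ δ * β * (((R * T : ℕ) : ℝ) * ∑ y ∈ face, ((r.N : ℝ) - (r.ρ (plaquetteHolonomy U y 0 1)).trace.re)) :=
          mul_le_mul_of_nonneg_left h1 hδβ
      _ = δ * ((R * T : ℕ) : ℝ) * β * ∑ y ∈ face, ((r.N : ℝ) - (r.ρ (plaquetteHolonomy U y 0 1)).trace.re) := by ring
  have hmult : ∀ y ∈ ({()} : Finset Unit).biUnion (fun _ => face),
      (({()} : Finset Unit).filter fun P => y ∈ (fun _ => face) P).card ≤ 1 := fun y _ =>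
    (Finset.card_filter_le _ _).trans (by simp)
  have hmain := hC L hL β hβ Unit {()} (fun _ => face)
    (fun _ U => δ * β * ((r.N : ℝ) - (r.ρ (rectangleHolonomy U x 0 1 R T)).trace.re))
    (δ * ((R * T : ℕ) : ℝ)) 1 ha hma hmult hdom
  simp only [Finset.sum_singleton, Finset.singleton_biUnion] at hmain
  refine hmain.trans (Real.exp_le_exp.2 ?_)
  have hcardface : (face.card : ℝ) ≤ ((R * T : ℕ) : ℝ) := by exact_mod_cast card_faceSites_le x R T
  have h2 : 0 ≤ C * (((1 : ℕ) : ℝ) * (δ * ((R * T : ℕ) : ℝ))) := mul_nonneg hC0 (by rw [Nat.cast_one, one_mul]; exact ha)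
  calc C * (((1 : ℕ) : ℝ) * (δ * ((R * T : ℕ) : ℝ))) * (face.card : ℝ)
      ≤ C * (((1 : ℕ) : ℝ) * (δ * ((R * T : ℕ) : ℝ))) * ((R * T : ℕ) : ℝ) := mul_le_mul_of_nonneg_left hcardface h2
    _ = C * δ * ((R : ℝ) * T) ^ 2 := by push_cast; ring

/-- **THE DECIMATION READING ON EVEN TORI, `01`-PLANE**: for every finite family of `b × b` squares in the `(0,1)`-plane (base points `x P`,
`b ≤ L`) — the `01`-plane coarse plaquettes of the side-`b` decimation of `U` — whose face site sets have multiplicity `≤ m`, and every `δ ≥ 0`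
with `m·δ·b² ≤ ½`: `∫ exp(δ·β·Σ_{P∈Q} (N − Re tr r(hol ∂P))) dμ_β ≤ exp((C∕2)·b²·#Q)` on every even four-torus, `β ≥ 4` — (LS) at scale 1 for
decimation, `01`-plane, even tori, UNCONDITIONAL. [folklore] -/
theorem localExpMoment_blockSquares_even01 (r : LatticeRep G) :
    ∃ C : ℝ, 0 ≤ C ∧ ∀ (L : ℕ) [NeZero L], Even L → ∀ (β : ℝ), 4 ≤ β →
      ∀ (κ : Type) (Q : Finset κ) (x : κ → Site 4 L) (b m : ℕ) (δ : ℝ),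
        0 ≤ δ → (m : ℝ) * (δ * ((b * b : ℕ) : ℝ)) ≤ 1 / 2 → b ≤ L →
        (∀ y ∈ Q.biUnion (fun P => (Finset.range b ×ˢ Finset.range b).image
            (fun st : ℕ × ℕ => (x P + Pi.single 0 (st.1 : ZMod L) + Pi.single 1 (st.2 : ZMod L) : Site 4 L))),
          (Q.filter fun P => y ∈ (Finset.range b ×ˢ Finset.range b).image
            (fun st : ℕ × ℕ => (x P + Pi.single 0 (st.1 : ZMod L) + Pi.single 1 (st.2 : ZMod L) : Site 4 L))).card ≤ m) →
        ∫ U, Real.exp (δ * β * ∑ P ∈ Q, ((r.N : ℝ) - (r.ρ (rectangleHolonomy U (x P) 0 1 b b)).trace.re))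
            ∂(wilsonMeasure r.ρ β : Measure (GaugeConfig 4 L G)) ≤
          Real.exp (C / 2 * ((b * b : ℕ) * Q.card)) := by
  obtain ⟨C, hC0, hC⟩ := localExpMoment_loopEnergies_even01 r
  refine ⟨C, hC0, fun L _ hL β hβ κ Q x b m δ hδ hsmall hb hmult => ?_⟩
  set F : κ → Finset (Site 4 L) := fun P => (Finset.range b ×ˢ Finset.range b).image
    (fun st : ℕ × ℕ => (x P + Pi.single 0 (st.1 : ZMod L) + Pi.single 1 (st.2 : ZMod L) : Site 4 L)) with hF
  have h := hC L hL β hβ κ Q x (fun _ => b) (fun _ => b) F (b * b) m (b * b) δ hδ hsmall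
    (fun _ _ => hb) (fun _ _ => hb) (fun _ _ => le_rfl) (fun P _ => by rw [hF]) hmult
    (fun P _ => card_faceSites_le (x P) b b)
  exact h

end LoopMoments

end Summit.QuantumFields.YangMills.BalabanUVNodes.N20LCSLoopEnergiesEven

end
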